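import Literature.NumberTheory.Automorphic.IdeleClassCharacterAutConjSelfDual
import Literature.NumberTheory.Automorphic.ClassFieldCharacterLocal
import Literature.NumberTheory.Automorphic.Liu2021.Thm418ValueField
import HarnessLib

/-!
# [Liu2021, Thm 4.18 (3), proof l. 2272–2290] — the number-theoretic core, step L3:
# `μ^{alg}(⟨√u⟩_w)² = μ[⟨−1⟩_w] · N(w)^{v_w(√u)}`, so `√c ∈ M_μ` for `c = ±N(w)^{v}`

Topic `NumberTheory/Automorphic/Liu2021`; namespaces `Literature.NumberTheory.Automorphic.IdeleClassGroup` (the CM-field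
vocabulary of `ConjugateSelfDualCharacters` / `IdeleClassCharacterAutConjSelfDual`: `L` a CM field, `L⁺ = maximalRealSubfield L`,
`ψ : IdeleClassGroup L →ₜ* Circle`, conjugate self-dual / symplectic, `μ^{alg} = muAlg`) and `Literature.NumberTheory.Automorphic.Liu2021`
(the AS-PRINTED carriers `muAlgValue`, `fieldOfValues = M_μ` of `Thm418AsPrinted.lean`).  Cell `hodgecm-mathlib` (D-0151), row III-11
(G2) `Thm418Data.EpsRigidUnderGaloisTwist`: that row STAYS a named fact (its representation-theoretic half needs bodies for the local
oscillator representations); this file banks the first of the three number-theoretic lemmas L3 → L2 → L1 of the corrected uniform proof of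
the printed reduction (A-p11 PREP-III11, director g1 03:21:04Z).  THEOREMS ONLY (no definition, no named fact, no instance; debt 0).
HC_CM is proved only modulo the 7 printed citations until rung 0 closes.

THE PRINT (Y. Liu, *Fourier–Jacobi cycles and arithmetic relative trace formula*, Camb. J. Math. 9 (2021) = arXiv:2102.11518,
`FJcycle.tex` l. 2272–2290, print pp. 53–54), VERBATIM (l. 2272): «Since `Gal(ℂ/M_μ)` stabilizes `μ` and by (2), it suffices to show that
for every rational prime `p`, the image of `Gal(ℂ/M_μ)` under the `p`-adic cyclotomic character `χ_p : Gal(ℂ/ℚ) → ℤ_p^×` is contained in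
`ℤ_p^× ∩ Nm_{E_𝔭/F_𝔭} E_𝔭^×` for every prime `𝔭` of `F` above `p`. […] Thus, our goal is to show that `M_{E/F}` is contained in `M_μ`.»;
(l. 2274) «Write `E = F(√u)` […] Then `μ(√u)² = μ(√u²) = μ(−Nm_{E/F} √u) = μ(−1)`»; (l. 2276) «since `μ(√u) = ±1`, we have `μ^{alg}(√u) =
± p^{f/2}`. Thus, `M_μ` contains `√p` as `f` is odd»; (l. 2278) «`μ^{alg}(√u) = ±√−1 p^{f/2}`»; (l. 2283) «`μ^{alg}(√u) = ±√−1` is contained in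
`M_μ`»; (l. 2285) «`μ^{alg}(√u) = ± 2^{f/2}`. In particular, `√2` is contained in `M_μ`».

WHAT THIS FILE PROVES — the ONE identity behind all five displayed evaluations, uniformly in `p` and in the residue degree (A-p11's
corrected proof; the printed sentence l. 2283 «Thus, we have `d < v_F(4)`. Then we can find `u ∈ O_F^×` such that `E = F(√u)`» is false
when `f(F/ℚ_2)` is even — lit1's instance `F = ℚ_2(√5)`, `E = F(√(2√5))`, shelf card BH06-Prop41_2 §5 — but the theorem is unaffected,
because the parity of `f · v_F(u)` is what matters, not the choice of `u`):
for a CONJUGATE SELF-DUAL unitary idele class character `ψ` of the CM field `L` (`ψ[y ȳ] = 1`; conjugate symplectic ⇒ conjugate self-dual,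
`IsConjugateSymplectic.isConjugateSelfDual`, [Liu2021] Remark 4.2), a finite place `w` of `L` FIXED by complex conjugation `c`
(`c • w = w`: `w` is the only place above `𝔭 = w ∩ L⁺`, e.g. `𝔭` ramified) and ANY `α ∈ L^×` with `c α = −α` (so `L = L⁺(α)`, `α² = u ∈ L⁺`):
* `smul_localUnits_of_smul_eq` — `σ • ⟨x⟩_w = ⟨σ x⟩_{w'}` along any `σ • w = w'` (transport form of the tree's `smul_localUnits`);
* `IsConjugateSelfDual.apply_mk_localUnits_sq` — **`ψ[⟨α⟩_w]² = ψ[⟨−1⟩_w]`** («`μ(√u)² = μ(−Nm √u) = μ(−1)`»): `c • ⟨α⟩_w = ⟨−α⟩_w`, so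
  `⟨α⟩_w · \overline{⟨α⟩_w} = ⟨−1⟩_w · ⟨α⟩_w²` is killed by `ψ`; and `apply_mk_localUnits_neg_one_sq` — `ψ[⟨−1⟩_w]² = 1`;
* `IsConjugateSelfDual.sq_coe_muAlg_localUnits` — **`μ^{alg}(⟨α⟩_w)² = ψ[⟨−1⟩_w] · ‖α‖_w⁻¹`** and `…_eq_zpow`: `= ψ[⟨−1⟩_w] · N(w)^{−n}` with
  `‖α‖_w = N(w)^{n}` (`n = −v_w(α) ∈ ℤ`; «`μ^{alg}(√u) = ± p^{f/2}`, `±√−1 p^{f/2}`, `±√−1`, `±2^{f/2}`» all at once);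
* `Liu2021.exists_mem_fieldOfValues_sq_eq` — **`√c ∈ M_μ`**: there is `z ∈ fieldOfValues L ψ` (= Liu's `M_μ`, `Thm418AsPrinted`) with
  `z² = ψ[⟨−1⟩_w] · N(w)^{−n}`, namely `z = μ^{alg}(⟨α⟩_w)` (values at finite idèles generate `M_μ`, l. 1928).
* §4 `IsConjugateSymplectic.coe_apply_mk_localUnits_neg_one` — for a conjugate SYMPLECTIC `ψ` the sign is **`ψ[⟨−1⟩_w] = ε_{L/L⁺}(⟨−1⟩_𝔭)`**,
  `𝔭 = w ∩ L⁺` (Liu's «`μ(−1)`», l. 2274; `w` is the only place above `𝔭`, `eq_of_under_eq_of_complexConj_smul_eq`, so `⟨−1⟩_w = (⟨−1⟩_𝔭)_L`).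
NOT HERE: L2 (cyclotomic: `σ(√c) = √c ⇒ (χ_p(σ), c)_p = 1`), L1 (the local norm group `ℤ_p^× ∩ Nm E_𝔭^× = {a : (a, c)_p = 1}`, deferred),
and anything representation-theoretic of (G2).

## References
* [Liu2021] Y. Liu, *Fourier–Jacobi cycles and arithmetic relative trace formula*, Camb. J. Math. 9 (2021), 1–147: Thm. 4.18 (3)
  (l. 2243) and its proof l. 2272–2290; Def. 4.1, Remark 4.2 (l. 1895–1913); §4.1 l. 1922–1928 (`μ^{alg}`, `M_μ`).
* [CasselsFrohlichANT1967] J. W. S. Cassels, A. Fröhlich (eds.), *Algebraic Number Theory* (1967), Ch. VII §1.1 (`σ` acts on places and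
  completions), Ch. II §16 (local components of the idèle norm).
-/

set_option autoImplicit false

noncomputable section

open scoped NNReal
open NumberField IsDedekindDomain

namespace Literature.NumberTheory.Automorphic

open GaloisRepresentations

/-! ## §0 Transport of a local idèle along `σ • w = w'` -/

section Transport

variable {F E : Type} [Field F] [Field E] [Algebra F E] [NumberField E]

/-- **`σ • ⟨x⟩_w = ⟨σ x⟩_{w'}` along ANY proof `h : σ • w = w'`** (the tree's `smul_localUnits` is the case `w' := σ • w`, `h := rfl`;
here `w'` may be syntactically different, e.g. `w' = w` for a place fixed by `σ`).  [cite: CasselsFrohlichANT1967, Ch. VII §1.1] -/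
theorem smul_localUnits_of_smul_eq (σ : E ≃ₐ[F] E) {w w' : HeightOneSpectrum (𝓞 E)} (h : σ • w = w')
    (x : (w.adicCompletion E)ˣ) :
    σ • localUnits w x = localUnits w' (galAdicCompletionUnitsEquiv (L := E) σ h x) := by
  subst h
  exact smul_localUnits F E σ w x

end Transport

namespace IdeleClassGroup

variable {L : Type} [Field L] [NumberField L]

/-! ## §1 «`μ(√u)² = μ(−Nm_{E/F} √u) = μ(−1)`»: `ψ[⟨α⟩_w]² = ψ[⟨−1⟩_w]` -/

/-- A non-zero global element stays non-zero in every completion (`L → L_w` is a ring homomorphism of fields). [folklore] -/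
private theorem coe_ne_zero_adicCompletion (w : HeightOneSpectrum (𝓞 L)) {α : L} (hα : α ≠ 0) : (α : w.adicCompletion L) ≠ 0 :=
  (map_ne_zero (algebraMap L (w.adicCompletion L))).2 hα

/-- `L → L_w` commutes with negation (Mathlib records `coe_add`, `coe_zero` for the structure `adicCompletion`). [folklore] -/
private theorem coe_neg_adicCompletion (w : HeightOneSpectrum (𝓞 L)) (α : L) :
    ((-α : L) : w.adicCompletion L) = -(α : w.adicCompletion L) := by
  refine eq_neg_of_add_eq_zero_left ?_
  rw [← HeightOneSpectrum.adicCompletion.coe_add, neg_add_cancel, HeightOneSpectrum.adicCompletion.coe_zero]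

/-- **`ψ[⟨−1⟩_w]² = 1`** — so Liu's sign «`μ(−1)`» is `±1` (l. 2276 «If `μ(−1) = 1`», l. 2278 «If `μ(−1) = −1`»): `⟨−1⟩_w² = ⟨1⟩_w = 1`.
[cite: Liu2021, proof of Thm. 4.18 (3), l. 2276–2278] -/
theorem apply_mk_localUnits_neg_one_sq (ψ : IdeleClassGroup L →ₜ* Circle) (w : HeightOneSpectrum (𝓞 L)) :
    ψ ((localUnits w (-1) : ideleGroup L) : IdeleClassGroup L) ^ 2 = 1 := by
  rw [← map_pow, ← QuotientGroup.mk_pow, ← map_pow, neg_one_sq, map_one, QuotientGroup.mk_one, map_one]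

variable [IsCMField L]

/-- **Complex conjugation on the local idèle of a purely imaginary element at a conjugation-fixed place**: if `c • w = w` and `c α = −α`
then `\overline{⟨α⟩_w} = c • ⟨α⟩_w = ⟨−α⟩_w = ⟨−1⟩_w · ⟨α⟩_w` (`⟨α⟩_w = localUnits w a`, `a = α ∈ L_w^×`). [cite: CasselsFrohlichANT1967, Ch. VII §1.1] [cite: Liu2021, proof of Thm. 4.18 (3), l. 2274 («μ(√u²) = μ(−Nm_{E/F}√u)»)] -/
theorem complexConj_smul_localUnits_of_coe_eq {w : HeightOneSpectrum (𝓞 L)} (hw : IsCMField.complexConj L • w = w) {α : L}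
    (hα : IsCMField.complexConj L α = -α) {a : (w.adicCompletion L)ˣ} (ha : (a : w.adicCompletion L) = α) :
    IsCMField.complexConj L • localUnits w a = localUnits w (-1) * localUnits w a := by
  rw [smul_localUnits_of_smul_eq (IsCMField.complexConj L) hw, ← map_mul]
  congr 1
  refine Units.ext ?_
  change galAdicCompletionMap (IsCMField.complexConj L) hw (a : w.adicCompletion L) =
    ((-1 * a : (w.adicCompletion L)ˣ) : w.adicCompletion L)
  rw [ha, galAdicCompletionMap_coe L _ hw, AlgEquiv.smul_def, hα, coe_neg_adicCompletion, Units.val_mul, Units.val_neg,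
    Units.val_one, neg_one_mul, ha]

/-- **«`μ(√u)² = μ(√u²) = μ(−Nm_{E/F} √u) = μ(−1)`» ([Liu2021] l. 2274) for a conjugate self-dual `ψ`**: at a finite place `w` of the CM
field `L` fixed by complex conjugation and for any purely imaginary `α ∈ L^×` (`c α = −α`; `α² = u ∈ L⁺`, `L = L⁺(√u)`),
`ψ[⟨α⟩_w]² = ψ[⟨−1⟩_w]` — since `⟨α⟩_w \overline{⟨α⟩_w} = ⟨−1⟩_w ⟨α⟩_w²` is a Galois norm, killed by `ψ` (`ψ[y ȳ] = 1`,
`isConjugateSelfDual_iff_mul_conj`), and `ψ[⟨−1⟩_w] = ψ[⟨−1⟩_w]⁻¹`. [cite: Liu2021, proof of Thm. 4.18 (3), l. 2274; Def. 4.1 («μ is trivial on Nm 𝔸_E^×»)] -/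
theorem IsConjugateSelfDual.apply_mk_localUnits_sq {ψ : IdeleClassGroup L →ₜ* Circle} (hψ : IsConjugateSelfDual L ψ)
    {w : HeightOneSpectrum (𝓞 L)} (hw : IsCMField.complexConj L • w = w) {α : L} (hα : IsCMField.complexConj L α = -α)
    {a : (w.adicCompletion L)ˣ} (ha : (a : w.adicCompletion L) = α) :
    ψ ((localUnits w a : ideleGroup L) : IdeleClassGroup L) ^ 2 = ψ ((localUnits w (-1) : ideleGroup L) : IdeleClassGroup L) := by
  set y : ideleGroup L := localUnits w a with hy
  set m : ideleGroup L := localUnits w (-1) with hm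
  have h1 : ψ ((y * IsCMField.complexConj L • y : ideleGroup L) : IdeleClassGroup L) = 1 :=
    (isConjugateSelfDual_iff_mul_conj ψ).1 hψ y
  rw [hy, complexConj_smul_localUnits_of_coe_eq hw hα ha, ← hy, ← hm, ← mul_assoc, mul_comm y m, mul_assoc, QuotientGroup.mk_mul,
    map_mul, QuotientGroup.mk_mul, map_mul, ← sq] at h1
  have h2 : ψ ((m : ideleGroup L) : IdeleClassGroup L) ^ 2 = 1 := apply_mk_localUnits_neg_one_sq ψ w
  -- `ψ[m] · ψ[y]² = 1` and `ψ[m]² = 1`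
  calc ψ ((y : ideleGroup L) : IdeleClassGroup L) ^ 2
      = ψ ((m : ideleGroup L) : IdeleClassGroup L) ^ 2 * ψ ((y : ideleGroup L) : IdeleClassGroup L) ^ 2 := by rw [h2, one_mul]
    _ = ψ ((m : ideleGroup L) : IdeleClassGroup L) * (ψ ((m : ideleGroup L) : IdeleClassGroup L) *
          ψ ((y : ideleGroup L) : IdeleClassGroup L) ^ 2) := by rw [sq, mul_assoc]
    _ = ψ ((m : ideleGroup L) : IdeleClassGroup L) := by rw [h1, mul_one]

/-! ## §2 «`μ^{alg}(√u) = ± p^{f/2}`, `± √−1 p^{f/2}`, `± √−1`, `± 2^{f/2}`»: `μ^{alg}(⟨α⟩_w)² = ψ[⟨−1⟩_w] · ‖α‖_w⁻¹` -/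

/-- **`μ^{alg}(⟨α⟩_w)² = ψ[⟨−1⟩_w] · ‖α‖_w⁻¹`** for a conjugate self-dual `ψ`, a conjugation-fixed finite place `w` and a purely imaginary
`α ∈ L^×`: `μ^{alg}(y)² = ψ[y]² · ‖y‖⁻¹` (`μ^{alg} = μ · ‖·‖^{−1/2}`, `coe_muAlg_apply`), `ψ[y]² = ψ[⟨−1⟩_w]` (§1) and `‖⟨α⟩_w‖ = ‖α‖_w`
(`ideleNorm_localUnits`).  This is the single identity behind the four printed evaluations of `μ^{alg}(√u)` (l. 2276, 2278, 2283, 2285).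
[cite: Liu2021, proof of Thm. 4.18 (3), l. 2274–2285; §4.1 l. 1922–1926 («μ^{alg} := μ · | |_E^{−1/2}»)] -/
theorem IsConjugateSelfDual.sq_coe_muAlg_localUnits {ψ : IdeleClassGroup L →ₜ* Circle} (hψ : IsConjugateSelfDual L ψ)
    {w : HeightOneSpectrum (𝓞 L)} (hw : IsCMField.complexConj L • w = w) {α : L} (hα : IsCMField.complexConj L α = -α)
    {a : (w.adicCompletion L)ˣ} (ha : (a : w.adicCompletion L) = α) :
    ((muAlg L ψ (localUnits w a) : ℂˣ) : ℂ) ^ 2 =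
      (ψ ((localUnits w (-1) : ideleGroup L) : IdeleClassGroup L) : ℂ) * ((‖(α : w.adicCompletion L)‖⁻¹ : ℝ) : ℂ) := by
  have hn : (0 : ℝ) ≤ GaloisRepresentations.ideleNorm (localUnits w a) := by
    rw [GaloisRepresentations.ideleNorm_localUnits]
    exact norm_nonneg _
  rw [coe_muAlg_apply, mul_pow, inv_pow, ← Complex.ofReal_pow, Real.sq_sqrt hn, GaloisRepresentations.ideleNorm_localUnits,
    ha, sq, ← Circle.coe_mul, ← sq, hψ.apply_mk_localUnits_sq hw hα ha, Complex.ofReal_inv]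

/-- **`μ^{alg}(⟨α⟩_w)² = ψ[⟨−1⟩_w] · N(w)^{−n}` when `‖α‖_w = N(w)^n`** (`n = −v_w(α)`; every `‖u‖_w`, `u ∈ L_w^×`, is such a power,
`norm_units_eq_absNorm_zpow`): the printed `± p^{f/2}`, `±√−1 p^{f/2}`, `±√−1`, `±2^{f/2}` (`N(𝔭) = p^f`, `w` ramified over `𝔭`, `u` a
uniformiser of `F` resp. a unit). [cite: Liu2021, proof of Thm. 4.18 (3), l. 2276–2285] -/
theorem IsConjugateSelfDual.sq_coe_muAlg_localUnits_eq_zpow {ψ : IdeleClassGroup L →ₜ* Circle} (hψ : IsConjugateSelfDual L ψ)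
    {w : HeightOneSpectrum (𝓞 L)} (hw : IsCMField.complexConj L • w = w) {α : L} (hα : IsCMField.complexConj L α = -α)
    {a : (w.adicCompletion L)ˣ} (ha : (a : w.adicCompletion L) = α) {n : ℤ}
    (hn : ‖(α : w.adicCompletion L)‖ = ((Ideal.absNorm w.asIdeal : ℕ) : ℝ) ^ n) :
    ((muAlg L ψ (localUnits w a) : ℂˣ) : ℂ) ^ 2 =
      (ψ ((localUnits w (-1) : ideleGroup L) : IdeleClassGroup L) : ℂ) * ((Ideal.absNorm w.asIdeal : ℕ) : ℂ) ^ (-n) := by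
  rw [hψ.sq_coe_muAlg_localUnits hw hα ha, hn, ← zpow_neg, Complex.ofReal_zpow, Complex.ofReal_natCast]

omit [IsCMField L] in
/-- `‖α‖_w` IS an integral power of `N(w)` (`‖u‖_w = N(w)^{−v_w(u)}`, tree `norm_units_eq_absNorm_zpow`). [cite: CasselsFrohlichANT1967, Ch. II §16] -/
theorem exists_norm_coe_adicCompletion_eq_zpow (w : HeightOneSpectrum (𝓞 L)) {α : L} (hα0 : α ≠ 0) :
    ∃ n : ℤ, ‖(α : w.adicCompletion L)‖ = ((Ideal.absNorm w.asIdeal : ℕ) : ℝ) ^ n :=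
  ⟨_, by simpa only [Units.val_mk0] using
    Ultrametric.AdicCompletion.norm_units_eq_absNorm_zpow L w (Units.mk0 (α : w.adicCompletion L) (coe_ne_zero_adicCompletion w hα0))⟩

end IdeleClassGroup

/-! ## §3 «… is contained in `M_μ`»: `√c ∈ fieldOfValues L ψ` for `c = ψ[⟨−1⟩_w] · N(w)^{−n}` -/

namespace Liu2021

open IdeleClassGroup

variable {L : Type} [Field L] [NumberField L] [IsCMField L]

/-- **«`μ^{alg}(√u)` … is contained in `M_μ`» — the square root of `c := ψ[⟨−1⟩_w] · N(w)^{−n}` lies in Liu's field of values `M_μ`**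
(`fieldOfValues L ψ` of `Thm418AsPrinted`, generated by the `μ^{alg}(x)`, `x_∞ = 1`): `z = μ^{alg}(⟨α⟩_w)` (a value at a finite idèle) has
`z² = c` (§2).  For the ramified `𝔭 | p` of the printed proof (`w` the place above `𝔭`, `α = √u`), `c = ±p^{f v_F(u)}` up to the sign
`ψ[⟨−1⟩_w] = μ(−1)`: this is «`M_μ` contains `√p`» (l. 2276), «`√−p`» (l. 2278), «`√−1`» (l. 2283), «`√2`» (l. 2285) in one statement, and for
`f` even it yields `√−1 ∈ M_μ` where the printed sentence l. 2283 fails (lit1's `F = ℚ_2(√5)`).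
[cite: Liu2021, proof of Thm. 4.18 (3), l. 2272–2285; §4.1 l. 1928 («M_μ ⊆ ℂ the subfield generated by values μ^{alg}(x) for x ∈ (𝔸_E^∞)^×»)] -/
theorem exists_mem_fieldOfValues_sq_eq {ψ : IdeleClassGroup L →ₜ* Circle} (hψ : IsConjugateSelfDual L ψ)
    {w : HeightOneSpectrum (𝓞 L)} (hw : IsCMField.complexConj L • w = w) {α : L} (hα : IsCMField.complexConj L α = -α)
    (hα0 : α ≠ 0) {n : ℤ} (hn : ‖(α : w.adicCompletion L)‖ = ((Ideal.absNorm w.asIdeal : ℕ) : ℝ) ^ n) :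
    ∃ z ∈ fieldOfValues L ψ,
      z ^ 2 = (ψ ((localUnits w (-1) : ideleGroup L) : IdeleClassGroup L) : ℂ) * ((Ideal.absNorm w.asIdeal : ℕ) : ℂ) ^ (-n) := by
  have hαw : (α : w.adicCompletion L) ≠ 0 := (map_ne_zero (algebraMap L (w.adicCompletion L))).2 hα0
  refine ⟨muAlgValue L ψ (localUnits w (Units.mk0 (α : w.adicCompletion L) hαw)), ?_, ?_⟩
  · rw [mem_fieldOfValues_iff, muAlgValue_eq_coe_muAlg]
    exact coe_muAlg_mem_muAlgValueField L ψ (localUnits_fst w _)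
  · rw [muAlgValue_eq_coe_muAlg]
    exact hψ.sq_coe_muAlg_localUnits_eq_zpow hw hα (Units.val_mk0 hαw) hn

/-- The same for a CONJUGATE SYMPLECTIC character — the hypothesis of [Liu2021] Thm. 4.18 (`Thm418Data.isConjugateSymplectic`), which
implies conjugate self-duality (Remark 4.2, `IsConjugateSymplectic.isConjugateSelfDual`). [cite: Liu2021, Remark 4.2; proof of Thm. 4.18 (3), l. 2272–2285] -/
theorem exists_mem_fieldOfValues_sq_eq_of_isConjugateSymplectic {ψ : IdeleClassGroup L →ₜ* Circle}
    (hψ : IsConjugateSymplectic L ψ) {w : HeightOneSpectrum (𝓞 L)} (hw : IsCMField.complexConj L • w = w) {α : L}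
    (hα : IsCMField.complexConj L α = -α) (hα0 : α ≠ 0) {n : ℤ}
    (hn : ‖(α : w.adicCompletion L)‖ = ((Ideal.absNorm w.asIdeal : ℕ) : ℝ) ^ n) :
    ∃ z ∈ fieldOfValues L ψ,
      z ^ 2 = (ψ ((localUnits w (-1) : ideleGroup L) : IdeleClassGroup L) : ℂ) * ((Ideal.absNorm w.asIdeal : ℕ) : ℂ) ^ (-n) :=
  exists_mem_fieldOfValues_sq_eq hψ.isConjugateSelfDual hw hα hα0 hn

end Liu2021

/-! ## §4 The sign: `ψ[⟨−1⟩_w] = ε_{L/L⁺}(⟨−1⟩_𝔭)` for a conjugate symplectic `ψ` (`𝔭 = w ∩ L⁺`) -/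

namespace IdeleClassGroup

variable {L : Type} [Field L] [NumberField L] [IsCMField L]

/-- **A conjugation-fixed finite place of the CM field `L` is the ONLY place above `𝔭 = w ∩ L⁺`**: the places above `𝔭` form one
`Gal(L/L⁺) = {1, c}`-orbit (`HeightOneSpectrum.mem_image_algEquiv_smul_iff`), which is `{w}` when `c • w = w`.
[cite: CasselsFrohlichANT1967, Ch. VII Prop. 1.2 (ii)] -/
theorem eq_of_under_eq_of_complexConj_smul_eq {w w' : HeightOneSpectrum (𝓞 L)} (hw : IsCMField.complexConj L • w = w)
    (h : w'.under (𝓞 (maximalRealSubfield L)) = w.under (𝓞 (maximalRealSubfield L))) : w' = w := by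
  classical
  have hmem := (HeightOneSpectrum.mem_image_algEquiv_smul_iff (maximalRealSubfield L) L w w').2 h
  obtain ⟨σ, -, rfl⟩ := Finset.mem_image.1 hmem
  have hσ : σ ∈ ({1, IsCMField.complexConj L} : Finset (L ≃ₐ[maximalRealSubfield L] L)) := by
    rw [← univ_algEquiv_maximalRealSubfield_eq_pair L]
    exact Finset.mem_univ σ
  rcases Finset.mem_insert.1 hσ with rfl | hσ'
  · exact one_smul _ _
  · rw [Finset.mem_singleton.1 hσ', hw]

/-- **`⟨−1⟩_w` is the base change of `⟨−1⟩_𝔭`** when `w` is fixed by complex conjugation (`𝔭 = w ∩ L⁺`; the base change of `⟨u⟩_𝔭` is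
`∏_{w' ∣ 𝔭} ⟨u⟩_{w'}`, `ideleBaseChange_localUnits`, and `w` is the only place above `𝔭`). [cite: CasselsFrohlichANT1967, Ch. II §14 and Ch. VII §4.3] -/
theorem localUnits_neg_one_eq_ideleBaseChange {w : HeightOneSpectrum (𝓞 L)} (hw : IsCMField.complexConj L • w = w) :
    (localUnits w (-1) : ideleGroup L) =
      AdeleRing.ideleBaseChange (maximalRealSubfield L) L (localUnits (w.under (𝓞 (maximalRealSubfield L))) (-1)) := by
  classical
  obtain ⟨cf, hcf, -⟩ := exists_localUnitsAbove L (w.under (𝓞 (maximalRealSubfield L)))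
    (-1 : ((w.under (𝓞 (maximalRealSubfield L))).adicCompletion (maximalRealSubfield L))ˣ)
  rw [ideleBaseChange_localUnits (E := L) (w.under (𝓞 (maximalRealSubfield L))) (-1) cf hcf {w}
    (fun w' => by
      rw [Finset.mem_singleton]
      exact ⟨fun h => h ▸ rfl, fun h => eq_of_under_eq_of_complexConj_smul_eq hw h⟩),
    Finset.prod_singleton]
  congr 1
  refine Units.ext ?_
  haveI : w.asIdeal.LiesOver (w.under (𝓞 (maximalRealSubfield L))).asIdeal := ⟨rfl⟩
  rw [hcf w rfl, Units.val_neg, Units.val_one, Units.val_neg, Units.val_one, map_neg, map_one]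

/-- **The sign `ψ[⟨−1⟩_w]` is the value of the quadratic character `ε_{L/L⁺}` of `L/L⁺` at `⟨−1⟩_𝔭`** for a conjugate SYMPLECTIC `ψ`
(`μ|_{𝔸_F^×} = μ_{E/F}`, [Liu2021] Def. 4.1): `ψ[⟨−1⟩_w] = ψ[(⟨−1⟩_𝔭)_L] = ε(⟨−1⟩_𝔭)` — Liu's «`μ(−1)`» (l. 2274), `= ±1` according as
`−1` is or is not a local norm from `L_w` at `𝔭` (the tree's `quadraticHeckeCharCM`, kernel `P · N J`).
[cite: Liu2021, Def. 4.1 and proof of Thm. 4.18 (3), l. 2274–2278 («μ(−1) = ±1»)] -/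
theorem IsConjugateSymplectic.coe_apply_mk_localUnits_neg_one {ψ : IdeleClassGroup L →ₜ* Circle}
    (hψ : IsConjugateSymplectic L ψ) {w : HeightOneSpectrum (𝓞 L)} (hw : IsCMField.complexConj L • w = w) :
    (ψ ((localUnits w (-1) : ideleGroup L) : IdeleClassGroup L) : ℂ) =
      ((quadraticHeckeCharCM L (localUnits (w.under (𝓞 (maximalRealSubfield L))) (-1)) : ℂˣ) : ℂ) := by
  rw [localUnits_neg_one_eq_ideleBaseChange hw, ← classBaseChange_mk, hψ, coe_quadraticClassCharCM_mk]

end IdeleClassGroup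

end Literature.NumberTheory.Automorphic

end
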